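import Literature.Analysis.FluidPDE.LerayEnstrophyAPrioriForced
import Literature.Analysis.FluidPDE.NSForcedH1ContinuationOfLocalExistence
import Literature.Analysis.FluidPDE.TaoClassGlue
import Literature.Analysis.FluidPDE.TaoH1AlmostRegularForced
import HarnessLib

/-!
# Tao 2013, Thm. 5.4 (ii)+(iv) WITH FORCING on the FULL printed lifespan
# `(‖u₀‖_{H¹} + ‖f‖_{L¹_t H¹_x})⁴ T ≤ c ν³`, from the forced smooth local existence fact

Analysis/FluidPDE proof file (cell `pub/ns-blowup`, seat `ns-blowup-lit` g11; no definitions, no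
named facts). Brick "P5" of the forced twin of `TaoH1AlmostRegularAssembly.lean` (discharge chain
`tao2011_smooth_local_existence_forced → tao2011_forced_H1_local_almost_regular`).

The tree's forced local existence fact F2 `tao2011_smooth_local_existence_forced`
(`TaoH1LocalExistenceForced.lean`; a THEOREM of the tree, `…_holds`) asks the smallness
`(A + B·T)⁴ T ≤ c ν³` with `B ≥ sup_{t ∈ [0,T]} ‖f(t)‖_{H¹}` — stronger than Tao's printed
hypothesis `(‖u₀‖_{H¹} + ‖f‖_{L¹_t H¹_x})⁴ T ≤ c`, in which only the time-INTEGRATED size of the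
force enters. This file upgrades F2 to the printed lifespan:

* `smooth_existence_forced_fullSlab` — from F2: there is an absolute `c > 0` such that for
  `ν, T > 0`, a smooth divergence-free `H^∞` datum `u₀` with `∫|u₀|² + ∫|∇u₀|² ≤ A`, a Clay-class
  force `f` (smooth on `[0,∞) × ℝ³`, Fefferman decay) with `∫₀ᵀ ‖f(t)‖_{H¹} dt ≤ B`, and
  `(√A + B)⁴ T ≤ c ν³`, there is a classical solution `(u, p)` of the forced system on the whole
  closed slab `[0, T] × ℝ³` in Tao's class (`u, ∂ₜu, p ∈ L^∞_t H^k_x`, `u ∈ C([0,T]; L²)`) with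
  `u 0 = u₀`.

## The argument (Tao 2013, proof of Thm. 5.4 (ii): the `X¹` a priori bound closes the iteration;
## Lemarié-Rieusset 2016, proof of Thm. 7.2: restart in uniform steps)

1. A PRIORI `H¹` RADIUS. Every Tao-class solution on a sub-slab `[0, T']`, `T' ≤ T`, from `u₀`
   obeys `∫|u(t)|² + ∫|∇u(t)|² ≤ A*²` for all `t ≤ T'`, with `A*` depending only on
   `A, B, ν` and two absolute constants: the energy part is Tao's Lemma 8.1 WITH force (the tree's
   theorem `tao2011_forced_finiteEnergy_energyBound_holds`), the gradient part is the forced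
   enstrophy a priori bound `exists_leray_enstrophy_apriori_forced` (`LerayEnstrophyAPrioriForced`,
   lifespan `(√A + B)⁴ T ≤ c ν³` — this is where the printed smallness is used).
2. UNIFORM STEP. With `B_F ≥ sup_{t ≥ 0} ‖f(t)‖_{H¹}` (Clay decay) choose `h > 0` with
   `(A* + B_F h)⁴ h ≤ c₁ ν³` (`c₁` the constant of F2).
3. ITERATION. F2 solves on `[0, h/2]`; given a Tao-class solution on `[0, Tₙ]`, `Tₙ < T`,
   restart F2 at `a = Tₙ − h/4` from `u(a)` (of size `≤ A*`) with the shifted force `f(· + a)`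
   (again Clay-class) for time `min(T − a, 3h/4)`, and GLUE (`taoClass_glue_forced`: the forced
   twin of the tree's `IsTaoSolutionOn.glue` — on the overlap the velocities agree by the forced
   uniqueness theorem `IsClassicalNSSolutionOn.velocity_eq_of_hasBoundedSobolevNormsOn`, the
   pressures by `gradient_pressure_eq_of_eqOn` and `eq_of_fderiv_eq_of_lintegral_sq_lt_top`, so no
   renormalisation is needed in the `L²` class). Each step gains `h/2` until `T` is reached.

## Mathlib / tree search

Tree (reused by name): `tao2011_smooth_local_existence_forced` (F2), the unforced closed-slab
glue `IsTaoSolutionOn.glue` and its helpers `ContinuousInLpOn.congr_eqOn/.comp_add_right/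
.union_of_isClosed`, `eq_of_fderiv_eq_of_lintegral_sq_lt_top`,
`IsClassicalNSSolutionOn.gradient_pressure_eq_of_eqOn` (`TaoClassGlue.lean`),
`IsClassicalNSSolutionOn.comp_add_right`, `timeDerivWithin_comp_add_right`
(`ClassicalSolutionGlue.lean`), `IsClassicalNSSolutionOn.velocity_eq_of_hasBoundedSobolevNormsOn`
(`ClassicalSobolevUniqueness.lean`), `TaoForcedHC.exists_H1_bound_force`,
`TaoForcedHC.exists_small_step` (`NSForcedH1ContinuationOfLocalExistence.lean`),
`HasRapidSpaceTimeDecay.timeShift`, `…hasUniformRapidDecayOn_Icc(_timeShift)`,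
`IsSmoothOnHalfSpace.isSmoothSpaceTimeOn_Icc(_timeShift)` (`ClayForceTimeShift.lean`). The Summits
side has a half-open continuation `FluidComputer/ForcedClassicalContinuation` (not importable
from `Literature/`); `lean search 'fullSlab|existence_forced_full'`: no hits.

## References

* T. Tao, *Localisation and compactness properties of the Navier–Stokes global regularity
  problem*, Anal. PDE 6 (2013) 25–107 = arXiv:1108.1165, Thm. 5.4 (ii)+(iv) (arXiv Thm. 31,
  p. 18). [Tao2011]
* P. G. Lemarié-Rieusset, *The Navier–Stokes Problem in the 21st Century*, CRC 2016, Thm. 7.2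
  and its proof (PDF p. 147). [LemarieRieusset2016]
-/

noncomputable section

open MeasureTheory Set Function Filter InnerProductSpace
open _root_.Topology
open scoped ENNReal NNReal ContDiff RealInnerProductSpace Laplacian

namespace Literature.Analysis.FluidPDE

/-! ### Gluing a forced restart onto a Tao-class solution (closed slabs, `L²` pressures) -/

section Glue

variable {ν : ℝ}

set_option maxHeartbeats 1600000 in
/-- **Gluing a restart onto a Tao-class solution of the FORCED system** (forced twin of
`IsTaoSolutionOn.glue`; the restart step in the proof of Lemarié-Rieusset 2016, Thm. 7.2, for
classical solutions on closed slabs). Let `(u₁, p₁)` be a classical solution with force `f` on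
`[0, T₁]` in Tao's class and `(u₂, p₂)` a classical solution with the shifted force `f(· + a)`
on `[0, T₂]` in Tao's class from the restart datum `u₁ a`, where `0 ≤ a < T₁ ≤ a + T₂`, `ν > 0`.
Then there is a Tao-class solution `(w, q)` with force `f` on `[0, a + T₂]` from `u₁ 0` which
coincides with `u₁` on `[0, T₁)`: `w = u₁`, `q = p₁` for `t < T₁` and `w = u₂(· − a)`,
`q = p₂(· − a)` for `t ≥ T₁`; on the overlap `[a, T₁]` the velocities agree by uniqueness of
classical solutions with bounded Sobolev norms
(`IsClassicalNSSolutionOn.velocity_eq_of_hasBoundedSobolevNormsOn`) and the pressures because two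
`L²(ℝ³)` functions with the same gradient are equal.
[cite: LemarieRieusset2016, Thm. 7.2 (proof), PDF p. 147] -/
theorem taoClass_glue_forced {T₁ T₂ a : ℝ}
    {f u₁ u₂ : ℝ → EuclideanSpace ℝ (Fin 3) → EuclideanSpace ℝ (Fin 3)}
    {p₁ p₂ : ℝ → EuclideanSpace ℝ (Fin 3) → ℝ}
    (h₁ : IsClassicalNSSolutionOn (Icc 0 T₁) ν f u₁ p₁)
    (hs₁ : HasBoundedSobolevNormsOn (Icc 0 T₁) u₁)
    (hd₁ : HasBoundedSobolevNormsOn (Icc 0 T₁) (timeDerivWithin (Icc 0 T₁) u₁))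
    (hq₁ : ∀ n : ℕ, ∃ C : ℝ≥0, ∀ t ∈ Icc 0 T₁, ∫⁻ x, ‖iteratedFDeriv ℝ n (p₁ t) x‖ₑ ^ 2 ≤ C)
    (hc₁ : ContinuousInLpOn (Icc 0 T₁) 2 u₁)
    (h₂ : IsClassicalNSSolutionOn (Icc 0 T₂) ν (fun t => f (t + a)) u₂ p₂)
    (hs₂ : HasBoundedSobolevNormsOn (Icc 0 T₂) u₂)
    (hd₂ : HasBoundedSobolevNormsOn (Icc 0 T₂) (timeDerivWithin (Icc 0 T₂) u₂))
    (hq₂ : ∀ n : ℕ, ∃ C : ℝ≥0, ∀ t ∈ Icc 0 T₂, ∫⁻ x, ‖iteratedFDeriv ℝ n (p₂ t) x‖ₑ ^ 2 ≤ C)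
    (hc₂ : ContinuousInLpOn (Icc 0 T₂) 2 u₂)
    (h₂0 : u₂ 0 = u₁ a) (hν : 0 < ν) (hT₂ : 0 < T₂) (ha : 0 ≤ a) (haT : a < T₁)
    (hT : T₁ ≤ a + T₂) :
    ∃ (w : ℝ → EuclideanSpace ℝ (Fin 3) → EuclideanSpace ℝ (Fin 3))
      (q : ℝ → EuclideanSpace ℝ (Fin 3) → ℝ),
      IsClassicalNSSolutionOn (Icc 0 (a + T₂)) ν f w q ∧ w 0 = u₁ 0 ∧
      HasBoundedSobolevNormsOn (Icc 0 (a + T₂)) w ∧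
      HasBoundedSobolevNormsOn (Icc 0 (a + T₂)) (timeDerivWithin (Icc 0 (a + T₂)) w) ∧
      (∀ n : ℕ, ∃ C : ℝ≥0, ∀ t ∈ Icc 0 (a + T₂), ∫⁻ x, ‖iteratedFDeriv ℝ n (q t) x‖ₑ ^ 2 ≤ C) ∧
      ContinuousInLpOn (Icc 0 (a + T₂)) 2 w ∧
      (∀ t, t < T₁ → w t = u₁ t) := by
  set b : ℝ := a + T₂ with hb
  have hT₁ : 0 < T₁ := ha.trans_lt haT
  have hT₁a : 0 < T₁ - a := by linarith
  have hT₁b : T₁ ≤ b := hT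
  -- the translate of `(u₁, p₁)` by `a`: a classical solution on `[0, T₁ - a]` with force `f(· + a)`
  have hpre₁ : (· + a) ⁻¹' Icc 0 T₁ = Icc (0 - a) (T₁ - a) := preimage_add_const_Icc a 0 T₁
  have hsub₁ : Icc 0 (T₁ - a) ⊆ (· + a) ⁻¹' Icc 0 T₁ := by
    rw [hpre₁]; exact Icc_subset_Icc_left (by linarith)
  have hmemT : ∀ {t : ℝ}, t ∈ Icc 0 (T₁ - a) → t + a ∈ Icc 0 T₁ := fun ht => hsub₁ ht
  have h₁a : IsClassicalNSSolutionOn (Icc 0 (T₁ - a)) ν (fun t => f (t + a)) (fun t => u₁ (t + a))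
      (fun t => p₁ (t + a)) :=
    (h₁.comp_add_right a).mono hsub₁ (uniqueDiffOn_Icc hT₁a)
  have hs₁a : HasBoundedSobolevNormsOn (Icc 0 (T₁ - a)) (fun t => u₁ (t + a)) := fun n => by
    obtain ⟨C, hC⟩ := hs₁ n
    exact ⟨C, fun t ht => hC (t + a) (hmemT ht)⟩
  -- the second piece restricted to `[0, T₁ - a]`
  have h₂a : IsClassicalNSSolutionOn (Icc 0 (T₁ - a)) ν (fun t => f (t + a)) u₂ p₂ :=
    h₂.mono (Icc_subset_Icc_right (by linarith)) (uniqueDiffOn_Icc hT₁a)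
  have hs₂a : HasBoundedSobolevNormsOn (Icc 0 (T₁ - a)) u₂ :=
    hs₂.mono (Icc_subset_Icc_right (by linarith))
  /- velocity agreement on the overlap `[a, T₁]` -/
  have hV' : ∀ s ∈ Icc 0 (T₁ - a), u₁ (s + a) = u₂ s := by
    intro s hs
    have h0 : (fun t => u₁ (t + a)) 0 = u₂ 0 := by simp [h₂0]
    exact h₁a.velocity_eq_of_hasBoundedSobolevNormsOn h₂a hν.le hT₁a hs₁a hs₂a h0 s hs
  have hV : ∀ t ∈ Icc a T₁, u₁ t = u₂ (t - a) := by
    intro t ht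
    have := hV' (t - a) ⟨by linarith [ht.1], by linarith [ht.2]⟩
    simpa using this
  /- pressure agreement on the overlap `[a, T₁]` -/
  have hP : ∀ t ∈ Icc a T₁, p₁ t = p₂ (t - a) := by
    intro t ht
    have hsI : t - a ∈ Icc 0 (T₁ - a) := ⟨by linarith [ht.1], by linarith [ht.2]⟩
    have hgrad : ∀ x, gradient (p₁ (t - a + a)) x = gradient (p₂ (t - a)) x := fun x =>
      h₁a.gradient_pressure_eq_of_eqOn h₂a Subset.rfl Subset.rfl hsI
        (uniqueDiffOn_Icc hT₁a _ hsI) hV' x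
    have ht₁ : t ∈ Icc 0 T₁ := ⟨ha.trans ht.1, ht.2⟩
    have ht₂ : t - a ∈ Icc 0 T₂ := ⟨hsI.1, by linarith [hsI.2]⟩
    have hd₁' : Differentiable ℝ (p₁ t) := (h₁.contDiff_pressure ht₁).differentiable (by simp)
    have hd₂' : Differentiable ℝ (p₂ (t - a)) := (h₂.contDiff_pressure ht₂).differentiable (by simp)
    have hD : ∀ x, fderiv ℝ (p₁ t) x = fderiv ℝ (p₂ (t - a)) x := fun x => by
      have hg := hgrad x
      rw [sub_add_cancel] at hg
      unfold gradient at hg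
      exact (InnerProductSpace.toDual ℝ (EuclideanSpace ℝ (Fin 3))).symm.injective hg
    have hL2 : ∀ {g : EuclideanSpace ℝ (Fin 3) → ℝ} {C : ℝ≥0},
        (∫⁻ x, ‖iteratedFDeriv ℝ 0 g x‖ₑ ^ 2 ≤ C) → ∫⁻ x, ‖g x‖ₑ ^ 2 < ⊤ := by
      intro g C h
      refine lt_of_le_of_lt (le_of_eq (lintegral_congr fun x => ?_)) (h.trans_lt ENNReal.coe_lt_top)
      rw [← ofReal_norm, ← ofReal_norm, norm_iteratedFDeriv_zero]
    obtain ⟨C₁, hC₁⟩ := hq₁ 0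
    obtain ⟨C₂, hC₂⟩ := hq₂ 0
    exact eq_of_fderiv_eq_of_lintegral_sq_lt_top hd₁' hd₂' hD (hL2 (hC₁ t ht₁)) (hL2 (hC₂ _ ht₂))
  /- pointwise descriptions of the glued fields -/
  set w : ℝ → EuclideanSpace ℝ (Fin 3) → EuclideanSpace ℝ (Fin 3) :=
    fun t => if t < T₁ then u₁ t else u₂ (t - a) with hw
  set q : ℝ → EuclideanSpace ℝ (Fin 3) → ℝ := fun t => if t < T₁ then p₁ t else p₂ (t - a) with hq
  have hw₁ : ∀ t, t < T₁ → w t = u₁ t := fun t ht => by simp only [hw, if_pos ht]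
  have hq₁' : ∀ t, t < T₁ → q t = p₁ t := fun t ht => by simp only [hq, if_pos ht]
  have hw₂ : ∀ t, a ≤ t → t ≤ b → w t = u₂ (t - a) := fun t hat _ => by
    by_cases htT : t < T₁
    · rw [hw₁ t htT, hV t ⟨hat, htT.le⟩]
    · simp only [hw, if_neg htT]
  have hq₂' : ∀ t, a ≤ t → t ≤ b → q t = p₂ (t - a) := fun t hat _ => by
    by_cases htT : t < T₁
    · rw [hq₁' t htT, hP t ⟨hat, htT.le⟩]
    · simp only [hq, if_neg htT]
  /- the two relatively open pieces -/
  have hI₁ : Icc 0 b ∩ Iio T₁ = Icc 0 T₁ ∩ Iio T₁ := Set.ext fun τ => by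
    simp only [mem_inter_iff, mem_Icc, mem_Iio]
    constructor <;> rintro ⟨⟨h0, -⟩, hτ⟩ <;> exact ⟨⟨h0, by linarith⟩, hτ⟩
  have hpre : (· + -a) ⁻¹' Icc 0 T₂ = Icc a b := by
    rw [preimage_add_const_Icc]; congr 1 <;> simp [hb, add_comm]
  have hI₂ : Icc 0 b ∩ Ioi a = ((· + -a) ⁻¹' Icc 0 T₂) ∩ Ioi a := Set.ext fun τ => by
    rw [hpre]
    simp only [mem_inter_iff, mem_Icc, mem_Ioi]
    constructor <;> rintro ⟨⟨h0, hτb⟩, hτ⟩ <;> exact ⟨⟨by linarith, hτb⟩, hτ⟩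
  -- smoothness of the translates of `u₂`, `p₂` on `[a, b] × ℝ³`
  have hsm₂u : ContDiffOn ℝ ∞ (uncurry fun t => u₂ (t - a)) (Icc a b ×ˢ univ) := by
    have h : ContDiffOn ℝ ∞ (uncurry fun t => u₂ (t + -a)) (((· + -a) ⁻¹' Icc 0 T₂) ×ˢ univ) :=
      h₂.smooth_velocity.comp_add_right (-a)
    rw [hpre] at h
    simpa [sub_eq_add_neg] using h
  have hsm₂p : ContDiffOn ℝ ∞ (uncurry fun t => p₂ (t - a)) (Icc a b ×ˢ univ) := by
    have h : ContDiffOn ℝ ∞ (uncurry fun t => p₂ (t + -a)) (((· + -a) ⁻¹' Icc 0 T₂) ×ˢ univ) :=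
      h₂.smooth_pressure.comp_add_right (-a)
    rw [hpre] at h
    simpa [sub_eq_add_neg] using h
  /- joint smoothness of the glued fields (local) -/
  have hsmooth : ∀ {F : Type} [NormedAddCommGroup F] [NormedSpace ℝ F]
      {g g₁ g₂ : ℝ → EuclideanSpace ℝ (Fin 3) → F}, ContDiffOn ℝ ∞ (uncurry g₁) (Icc 0 T₁ ×ˢ univ) →
      ContDiffOn ℝ ∞ (uncurry g₂) (Icc a b ×ˢ univ) →
      (∀ t, t < T₁ → g t = g₁ t) → (∀ t, a ≤ t → t ≤ b → g t = g₂ t) →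
      ContDiffOn ℝ ∞ (uncurry g) (Icc 0 b ×ˢ univ) := by
    intro F _ _ g g₁ g₂ hg₁ hg₂ he₁ he₂
    refine contDiffOn_of_locally_contDiffOn fun z hz => ?_
    obtain ⟨t, x⟩ := z
    have ht : t ∈ Icc 0 b := hz.1
    by_cases htT : t < T₁
    · refine ⟨Iio T₁ ×ˢ univ, isOpen_Iio.prod isOpen_univ, ⟨htT, mem_univ _⟩, ?_⟩
      rw [prod_inter_prod, univ_inter, hI₁]
      refine (hg₁.mono (prod_mono inter_subset_left Subset.rfl)).congr fun z hz => ?_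
      obtain ⟨τ, y⟩ := z
      have hτ : τ < T₁ := hz.1.2
      simp only [uncurry_apply_pair, he₁ τ hτ]
    · have hat : a < t := haT.trans_le (not_lt.1 htT)
      refine ⟨Ioi a ×ˢ univ, isOpen_Ioi.prod isOpen_univ, ⟨hat, mem_univ _⟩, ?_⟩
      rw [prod_inter_prod, univ_inter]
      have hsub : Icc 0 b ∩ Ioi a ⊆ Icc a b := fun τ hτ => ⟨le_of_lt hτ.2, hτ.1.2⟩
      refine (hg₂.mono (prod_mono hsub Subset.rfl)).congr fun z hz => ?_
      obtain ⟨τ, y⟩ := z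
      have hτ : a < τ := hz.1.2
      have hτb : τ ≤ b := hz.1.1.2
      simp only [uncurry_apply_pair, he₂ τ hτ.le hτb]
  have hsmw : IsSmoothSpaceTimeOn (Icc 0 b) w := hsmooth h₁.smooth_velocity hsm₂u hw₁ hw₂
  have hsmq : IsSmoothSpaceTimeOn (Icc 0 b) q := hsmooth h₁.smooth_pressure hsm₂p hq₁' hq₂'
  /- the one-sided time derivative of the glued velocity -/
  have hD₁ : ∀ t ∈ Icc 0 b, t < T₁ → ∀ x,
      timeDerivWithin (Icc 0 b) w t x = timeDerivWithin (Icc 0 T₁) u₁ t x := by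
    intro t ht htT x
    have hev : (fun τ => w τ x) =ᶠ[𝓝 t] fun τ => u₁ τ x := by
      filter_upwards [Iio_mem_nhds htT] with τ hτ
      rw [hw₁ τ hτ]
    simp only [timeDerivWithin_apply]
    rw [(hev.filter_mono nhdsWithin_le_nhds).derivWithin_eq (by rw [hw₁ t htT]),
      ← derivWithin_inter (Iio_mem_nhds htT), hI₁, derivWithin_inter (Iio_mem_nhds htT)]
  have hD₂ : ∀ t ∈ Icc 0 b, ¬ t < T₁ → ∀ x,
      timeDerivWithin (Icc 0 b) w t x = timeDerivWithin (Icc 0 T₂) u₂ (t - a) x := by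
    intro t ht htT x
    have hat : a < t := haT.trans_le (not_lt.1 htT)
    have hev : (fun τ => w τ x) =ᶠ[𝓝[Icc 0 b] t] fun τ => u₂ (τ + -a) x := by
      filter_upwards [inter_mem_nhdsWithin (Icc 0 b) (Ioi_mem_nhds hat), self_mem_nhdsWithin]
        with τ hτ hτb
      rw [hw₂ τ (le_of_lt hτ.2) hτb.2, sub_eq_add_neg]
    simp only [timeDerivWithin_apply]
    rw [hev.derivWithin_eq (by rw [hw₂ t hat.le ht.2, sub_eq_add_neg]),
      ← derivWithin_inter (Ioi_mem_nhds hat), hI₂, derivWithin_inter (Ioi_mem_nhds hat)]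
    have h := timeDerivWithin_comp_add_right (Icc 0 T₂) u₂ (-a) t x
    simp only [timeDerivWithin_apply] at h
    rw [h, ← sub_eq_add_neg]
  /- membership bookkeeping -/
  have hmem₁ : ∀ {t : ℝ}, t ∈ Icc 0 b → t < T₁ → t ∈ Icc 0 T₁ := fun ht htT => ⟨ht.1, htT.le⟩
  have hmem₂ : ∀ {t : ℝ}, t ∈ Icc 0 b → ¬ t < T₁ → t - a ∈ Icc 0 T₂ := fun {t} ht htT =>
    ⟨by linarith [not_lt.1 htT], by rw [hb] at ht; linarith [ht.2]⟩
  refine ⟨w, q, ⟨hsmw, hsmq, ?_, ?_⟩, ?_, ?_, ?_, ?_, ?_, hw₁⟩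
  · -- momentum
    intro t ht x
    by_cases htT : t < T₁
    · rw [hD₁ t ht htT x, hw₁ t htT, hq₁' t htT]
      exact h₁.momentum t (hmem₁ ht htT) x
    · have hat : a ≤ t := (haT.trans_le (not_lt.1 htT)).le
      rw [hD₂ t ht htT x, hw₂ t hat ht.2, hq₂' t hat ht.2]
      have h := h₂.momentum (t - a) (hmem₂ ht htT) x
      simpa using h
  · -- incompressibility
    intro t ht
    by_cases htT : t < T₁
    · rw [hw₁ t htT]; exact h₁.divFree t (hmem₁ ht htT)
    · rw [hw₂ t (haT.trans_le (not_lt.1 htT)).le ht.2]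
      exact h₂.divFree (t - a) (hmem₂ ht htT)
  · -- datum
    exact hw₁ 0 hT₁
  · -- Sobolev bounds of `w`
    intro n
    obtain ⟨C₁, hC₁⟩ := hs₁ n
    obtain ⟨C₂, hC₂⟩ := hs₂ n
    refine ⟨max C₁ C₂, fun t ht => ?_⟩
    by_cases htT : t < T₁
    · rw [hw₁ t htT]
      exact (hC₁ t (hmem₁ ht htT)).trans (ENNReal.coe_le_coe.2 (le_max_left _ _))
    · rw [hw₂ t (haT.trans_le (not_lt.1 htT)).le ht.2]
      exact (hC₂ (t - a) (hmem₂ ht htT)).trans (ENNReal.coe_le_coe.2 (le_max_right _ _))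
  · -- Sobolev bounds of `∂ₜw`
    intro n
    obtain ⟨C₁, hC₁⟩ := hd₁ n
    obtain ⟨C₂, hC₂⟩ := hd₂ n
    refine ⟨max C₁ C₂, fun t ht => ?_⟩
    by_cases htT : t < T₁
    · have heq : timeDerivWithin (Icc 0 b) w t = timeDerivWithin (Icc 0 T₁) u₁ t :=
        funext fun x => hD₁ t ht htT x
      rw [heq]
      exact (hC₁ t (hmem₁ ht htT)).trans (ENNReal.coe_le_coe.2 (le_max_left _ _))
    · have heq : timeDerivWithin (Icc 0 b) w t = timeDerivWithin (Icc 0 T₂) u₂ (t - a) :=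
        funext fun x => hD₂ t ht htT x
      rw [heq]
      exact (hC₂ (t - a) (hmem₂ ht htT)).trans (ENNReal.coe_le_coe.2 (le_max_right _ _))
  · -- Sobolev bounds of `q`
    intro n
    obtain ⟨C₁, hC₁⟩ := hq₁ n
    obtain ⟨C₂, hC₂⟩ := hq₂ n
    refine ⟨max C₁ C₂, fun t ht => ?_⟩
    by_cases htT : t < T₁
    · rw [hq₁' t htT]
      exact (hC₁ t (hmem₁ ht htT)).trans (ENNReal.coe_le_coe.2 (le_max_left _ _))
    · rw [hq₂' t (haT.trans_le (not_lt.1 htT)).le ht.2]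
      exact (hC₂ (t - a) (hmem₂ ht htT)).trans (ENNReal.coe_le_coe.2 (le_max_right _ _))
  · -- `w ∈ C([0, b]; L²)`: on `[0, m₀]` it is `u₁`, on `[a, b]` it is `u₂(· - a)`
    set m₀ : ℝ := (a + T₁) / 2 with hm₀
    have ham₀ : a < m₀ := by rw [hm₀]; linarith
    have hm₀T : m₀ < T₁ := by rw [hm₀]; linarith
    have hK₁ : ContinuousInLpOn (Icc 0 m₀) 2 w :=
      (hc₁.mono (Icc_subset_Icc_right hm₀T.le)).congr_eqOn fun t ht =>
        (hw₁ t (ht.2.trans_lt hm₀T)).symm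
    have hK₂ : ContinuousInLpOn (Icc a b) 2 w := by
      have h := hc₂.comp_add_right (-a)
      rw [hpre] at h
      exact h.congr_eqOn fun t ht => by rw [hw₂ t ht.1 ht.2, sub_eq_add_neg]
    have hunion : Icc 0 m₀ ∪ Icc a b = Icc 0 b := by
      refine Subset.antisymm (union_subset (Icc_subset_Icc_right (by linarith))
        (Icc_subset_Icc_left ha)) fun t ht => ?_
      rcases le_or_gt t m₀ with h | h
      · exact Or.inl ⟨ht.1, h⟩
      · exact Or.inr ⟨(ham₀.trans h).le, ht.2⟩
    rw [← hunion]
    exact hK₁.union_of_isClosed hK₂ isClosed_Icc isClosed_Icc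

end Glue

/-! ### Force-size conversions -/

section Conversions

variable {T : ℝ} {f : ℝ → EuclideanSpace ℝ (Fin 3) → EuclideanSpace ℝ (Fin 3)}

/-- `∫₀^{T'} ‖f(t)‖_{L²} dt ≤ ∫₀ᵀ ‖f(t)‖_{H¹} dt` (`T' ≤ T`), in the `ℝ≥0∞` currencies of the forced
energy bound (`TaoForcedNormalisedPressure`) and of the `H¹` theory (`eH1NormSq`). [folklore] -/
private theorem lintegral_Icc_sqrt_energy_le {T' : ℝ} (hT' : T' ≤ T) :
    ∫⁻ t in Icc 0 T', (∫⁻ x, ‖f t x‖ₑ ^ 2) ^ (1 / 2 : ℝ) ≤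
      ∫⁻ t in Ioo 0 T, eH1NormSq (f t) ^ (2⁻¹ : ℝ) := by
  rw [setLIntegral_congr (Ioo_ae_eq_Icc (μ := volume) (a := (0 : ℝ)) (b := T')).symm]
  refine (lintegral_mono_set (Ioo_subset_Ioo le_rfl hT')).trans (lintegral_mono fun t => ?_)
  rw [one_div]
  refine ENNReal.rpow_le_rpow ?_ (by norm_num)
  rw [eH1NormSq_def]
  exact le_self_add

/-- `∫₀^{T'} ‖∇f(t)‖_{L²} dt ≤ B` (real interval integral, `0 < T' ≤ T`) from the `ℝ≥0∞` bound
`∫₀ᵀ ‖f(t)‖_{H¹} dt ≤ B`, for a force with `C¹` slices and continuous `t ↦ ∫|∇f(t)|²`. [folklore] -/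
private theorem integral_sqrt_frob_le {T' B : ℝ} (hT'0 : 0 < T') (hT' : T' ≤ T) (hB : 0 ≤ B)
    (hf1 : ∀ t ∈ Icc 0 T, ContDiff ℝ 1 (f t))
    (hGfc : ContinuousOn (fun t => ∫ x, frobeniusNormSq (fderiv ℝ (f t) x)) (Icc 0 T))
    (hGfeq : ∀ t ∈ Icc 0 T, ENNReal.ofReal (∫ x, frobeniusNormSq (fderiv ℝ (f t) x)) =
      ∫⁻ x, ENNReal.ofReal (frobeniusNormSq (fderiv ℝ (f t) x)))
    (hBf : ∫⁻ t in Ioo 0 T, eH1NormSq (f t) ^ (2⁻¹ : ℝ) ≤ ENNReal.ofReal B) :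
    ∫ t in (0 : ℝ)..T', Real.sqrt (∫ x, frobeniusNormSq (fderiv ℝ (f t) x)) ≤ B := by
  obtain ⟨g, hg⟩ : ∃ g : ℝ → ℝ,
      g = fun t => Real.sqrt (∫ x, frobeniusNormSq (fderiv ℝ (f t) x)) := ⟨_, rfl⟩
  have hgt : ∀ t, g t = Real.sqrt (∫ x, frobeniusNormSq (fderiv ℝ (f t) x)) := fun t => by rw [hg]
  have hgc : ContinuousOn g (Icc 0 T) := by
    rw [hg]; exact Real.continuous_sqrt.comp_continuousOn hGfc
  have hg0 : ∀ t, 0 ≤ g t := fun t => by rw [hgt]; exact Real.sqrt_nonneg _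
  -- pointwise: `ofReal (g t) ≤ ‖f(t)‖_{H¹}`
  have hpt : ∀ t ∈ Icc 0 T, ENNReal.ofReal (g t) ≤ eH1NormSq (f t) ^ (2⁻¹ : ℝ) := by
    intro t ht
    have h1 : ENNReal.ofReal (g t) =
        (∫⁻ x, ENNReal.ofReal (frobeniusNormSq (fderiv ℝ (f t) x))) ^ (2⁻¹ : ℝ) := by
      rw [hgt, Real.sqrt_eq_rpow, ← ENNReal.ofReal_rpow_of_nonneg
        (integral_nonneg fun _ => frobeniusNormSq_nonneg _) (by norm_num), hGfeq t ht, one_div]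
    rw [h1, ← eWeakGradL2Sq_eq_of_hasWeakGradient (hasWeakGradient_fderiv_of_contDiff (hf1 t ht)),
      eH1NormSq_def]
    exact ENNReal.rpow_le_rpow le_add_self (by norm_num)
  simp only [← hgt]
  rw [intervalIntegral.integral_of_le hT'0.le]
  have hmeas : AEStronglyMeasurable g (volume.restrict (Ioc 0 T')) :=
    (hgc.mono (Ioc_subset_Icc_self.trans (Icc_subset_Icc_right hT'))).aestronglyMeasurable
      measurableSet_Ioc
  rw [integral_eq_lintegral_of_nonneg_ae (Eventually.of_forall hg0) hmeas]
  refine ENNReal.toReal_le_of_le_ofReal hB ?_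
  calc ∫⁻ t in Ioc 0 T', ENNReal.ofReal (g t)
      ≤ ∫⁻ t in Ioc 0 T', eH1NormSq (f t) ^ (2⁻¹ : ℝ) :=
        setLIntegral_mono' measurableSet_Ioc fun t ht => hpt t ⟨ht.1.le, ht.2.trans hT'⟩
    _ = ∫⁻ t in Ioo 0 T', eH1NormSq (f t) ^ (2⁻¹ : ℝ) :=
        setLIntegral_congr (Ioo_ae_eq_Ioc (μ := volume) (a := (0 : ℝ)) (b := T')).symm
    _ ≤ ∫⁻ t in Ioo 0 T, eH1NormSq (f t) ^ (2⁻¹ : ℝ) := lintegral_mono_set (Ioo_subset_Ioo le_rfl hT')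
    _ ≤ ENNReal.ofReal B := hBf

end Conversions

/-! ### The printed lifespan -/

section FullSlab

set_option maxHeartbeats 3200000 in
/-- **Tao 2013, Thm. 5.4 (ii)+(iv) WITH FORCING, on the full printed lifespan.** Assume the forced
smooth local existence fact `tao2011_smooth_local_existence_forced` (a theorem of the tree). There
is an absolute constant `c > 0` such that: for `ν > 0`, `T > 0`, a smooth divergence-free datum
`u₀` with `∫‖Dⁿu₀‖² < ∞` for all `n` and `∫|u₀|² + ∫|∇u₀|² ≤ A`, a Clay-class force `f` (smooth on
`[0, ∞) × ℝ³` with Fefferman's space–time decay) with `∫₀ᵀ ‖f(t)‖_{H¹} dt ≤ B`, and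
`(√A + B)⁴ T ≤ c ν³` — Tao's printed hypothesis `(‖u₀‖_{H¹_x} + ‖f‖_{L¹_t H¹_x})⁴ T ≤ c` after the
footnote-3 rescaling — there is a classical solution `(u, p)` of the Navier–Stokes system with
force `f` on the CLOSED slab `[0, T] × ℝ³` with `u 0 = u₀`, `u, ∂ₜu, p ∈ L^∞_t H^k_x([0, T])` for
all `k` and `u ∈ C([0, T]; L²)`. Proof: the forced enstrophy a priori bound
(`exists_leray_enstrophy_apriori_forced`, whose constant is `c`) and Tao's forced energy bound give
a uniform `H¹` radius on every sub-slab; F2 is restarted in uniform steps and glued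
(`taoClass_glue_forced`). [cite: Tao2011, Thm. 5.4 (ii)+(iv) (arXiv Thm. 31)] -/
theorem smooth_existence_forced_fullSlab (hF2 : tao2011_smooth_local_existence_forced) :
    ∃ c : ℝ, 0 < c ∧ ∀ ⦃ν T : ℝ⦄, 0 < ν → 0 < T →
      ∀ ⦃u₀ : EuclideanSpace ℝ (Fin 3) → EuclideanSpace ℝ (Fin 3)⦄,
        ContDiff ℝ ∞ u₀ → VectorCalculus.IsDivFree u₀ →
        (∀ n : ℕ, ∫⁻ x, ‖iteratedFDeriv ℝ n u₀ x‖ₑ ^ 2 < ⊤) →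
      ∀ ⦃f : ℝ → EuclideanSpace ℝ (Fin 3) → EuclideanSpace ℝ (Fin 3)⦄,
        IsSmoothOnHalfSpace f → HasRapidSpaceTimeDecay f →
      ∀ ⦃A B : ℝ⦄, 0 ≤ A → 0 ≤ B →
        (∫⁻ x, ‖u₀ x‖ₑ ^ 2) + (∫⁻ x, ENNReal.ofReal (frobeniusNormSq (fderiv ℝ u₀ x))) ≤
            ENNReal.ofReal A →
        ∫⁻ t in Ioo 0 T, eH1NormSq (f t) ^ (2⁻¹ : ℝ) ≤ ENNReal.ofReal B →
        (Real.sqrt A + B) ^ 4 * T ≤ c * ν ^ 3 →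
        ∃ (u : ℝ → EuclideanSpace ℝ (Fin 3) → EuclideanSpace ℝ (Fin 3))
          (p : ℝ → EuclideanSpace ℝ (Fin 3) → ℝ),
          IsClassicalNSSolutionOn (Icc 0 T) ν f u p ∧ u 0 = u₀ ∧
          HasBoundedSobolevNormsOn (Icc 0 T) u ∧
          HasBoundedSobolevNormsOn (Icc 0 T) (timeDerivWithin (Icc 0 T) u) ∧
          (∀ n : ℕ, ∃ C : ℝ≥0, ∀ t ∈ Icc 0 T, ∫⁻ x, ‖iteratedFDeriv ℝ n (p t) x‖ₑ ^ 2 ≤ C) ∧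
          ContinuousInLpOn (Icc 0 T) 2 u := by
  obtain ⟨c₁, hc₁, hloc⟩ := hF2
  obtain ⟨c₂, K, hc₂, hK, hapr⟩ := exists_leray_enstrophy_apriori_forced
  obtain ⟨CE, hCEtop, hEn⟩ := tao2011_forced_finiteEnergy_energyBound_holds
  refine ⟨c₂, hc₂, ?_⟩
  intro ν T hν hT u₀ hu₀ hdiv hH f hfs hfd A B hA hB h0 hBf hsmall
  set M : ℝ := Real.sqrt A + B with hM
  have hM0 : 0 ≤ M := add_nonneg (Real.sqrt_nonneg _) hB
  -- slab facts for the force on `[0, T]`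
  have hfS : IsSmoothSpaceTimeOn (Icc 0 T) f := hfs.isSmoothSpaceTimeOn_Icc T
  have hfD : HasUniformRapidDecayOn (Icc 0 T) f := hfd.hasUniformRapidDecayOn_Icc hfs hT
  obtain ⟨hfB, hfB'⟩ := hfD.hasBoundedSobolevNormsOn_Icc hfS hT
  obtain ⟨F₁, hF₁⟩ := hfB 1
  obtain ⟨F₁', hF₁'⟩ := hfB' 1
  have hf1 : ∀ t ∈ Icc 0 T, ContDiff ℝ 1 (f t) := fun t ht =>
    (hfS.contDiff_slice ht).of_le (by norm_cast)
  obtain ⟨-, hGfc, -⟩ := hfS.enstrophy_balance hT hF₁ hF₁'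
  have hGfeq : ∀ t ∈ Icc 0 T, ENNReal.ofReal (∫ x, frobeniusNormSq (fderiv ℝ (f t) x)) =
      ∫⁻ x, ENNReal.ofReal (frobeniusNormSq (fderiv ℝ (f t) x)) := by
    intro t ht
    have n1 : ∀ x, ‖fderiv ℝ (f t) x‖ = ‖iteratedFDeriv ℝ 1 (f t) x‖ := fun x => by
      rw [← norm_iteratedFDeriv_fderiv, norm_iteratedFDeriv_zero]
    have hDf : ∫⁻ x, ‖fderiv ℝ (f t) x‖ₑ ^ 2 < ⊤ :=
      lintegral_enorm_sq_lt_top_of_norm_le (fun x => (n1 x).le)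
        ((hF₁ t ht).trans_lt ENNReal.coe_lt_top)
    have hlt : ∫⁻ x, ENNReal.ofReal (frobeniusNormSq (fderiv ℝ (f t) x)) < ⊤ :=
      calc ∫⁻ x, ENNReal.ofReal (frobeniusNormSq (fderiv ℝ (f t) x))
          ≤ ∫⁻ x, 3 * ‖fderiv ℝ (f t) x‖ₑ ^ 2 :=
            lintegral_mono fun x => ofReal_frobeniusNormSq_le_three_mul_enorm_sq _
        _ = 3 * ∫⁻ x, ‖fderiv ℝ (f t) x‖ₑ ^ 2 := lintegral_const_mul' _ _ (by norm_num)
        _ < ⊤ := ENNReal.mul_lt_top (by norm_num) hDf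
    have hint : Integrable (fun x => frobeniusNormSq (fderiv ℝ (f t) x)) volume :=
      integrable_of_continuous_of_nonneg (continuous_frobeniusNormSq_fderiv (hf1 t ht) one_ne_zero)
        (fun x => frobeniusNormSq_nonneg _) hlt
    exact ofReal_integral_eq_lintegral_ofReal hint
      (Eventually.of_forall fun x => frobeniusNormSq_nonneg _)
  -- force-size conversions
  have hfE : ∀ {T' : ℝ}, T' ≤ T →
      ∫⁻ t in Icc 0 T', (∫⁻ x, ‖f t x‖ₑ ^ 2) ^ (1 / 2 : ℝ) ≤ ENNReal.ofReal B := fun hle =>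
    (lintegral_Icc_sqrt_energy_le hle).trans hBf
  have hBG : ∀ {T' : ℝ}, 0 < T' → T' ≤ T →
      ∫ t in (0 : ℝ)..T', Real.sqrt (∫ x, frobeniusNormSq (fderiv ℝ (f t) x)) ≤ B :=
    fun hT'0 hle => integral_sqrt_frob_le hT'0 hle hB hf1 hGfc hGfeq hBf
  -- the `H¹` size of the slices of the force, uniformly in `t ≥ 0`
  obtain ⟨BF, hBF0, hBF⟩ := TaoForcedHC.exists_H1_bound_force hfs hfd
  -- the a priori `H¹` radius
  set Eb : ℝ≥0∞ := CE * (ENNReal.ofReal A ^ (1 / 2 : ℝ) + ENNReal.ofReal B) ^ 2 with hEb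
  have hEbtop : Eb < ⊤ := by
    refine ENNReal.mul_lt_top hCEtop (ENNReal.pow_lt_top (ENNReal.add_lt_top.2 ⟨?_, ?_⟩))
    · exact ENNReal.rpow_lt_top_of_nonneg (by norm_num) ENNReal.ofReal_ne_top
    · exact ENNReal.ofReal_lt_top
  set Astar : ℝ := Real.sqrt (Eb.toReal + K * M ^ 2 + A) with hAstar
  have hAstar0 : 0 ≤ Astar := Real.sqrt_nonneg _
  have hAstar_sq : Astar ^ 2 = Eb.toReal + K * M ^ 2 + A :=
    Real.sq_sqrt (by positivity)
  have hA_le : ENNReal.ofReal A ≤ ENNReal.ofReal (Astar ^ 2) :=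
    ENNReal.ofReal_le_ofReal (by rw [hAstar_sq]; nlinarith [ENNReal.toReal_nonneg (a := Eb), sq_nonneg M, hK.le])
  have hzero : ∀ {g : EuclideanSpace ℝ (Fin 3) → EuclideanSpace ℝ (Fin 3)} {C : ℝ≥0},
      (∫⁻ x, ‖iteratedFDeriv ℝ 0 g x‖ₑ ^ 2 ≤ C) → ∫⁻ x, ‖g x‖ₑ ^ 2 ≤ C := by
    intro g C h
    refine (le_of_eq (lintegral_congr fun x => ?_)).trans h
    rw [← ofReal_norm, ← ofReal_norm, norm_iteratedFDeriv_zero]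
  have hapriori : ∀ ⦃T' : ℝ⦄, 0 < T' → T' ≤ T →
      ∀ ⦃u : ℝ → EuclideanSpace ℝ (Fin 3) → EuclideanSpace ℝ (Fin 3)⦄
        ⦃p : ℝ → EuclideanSpace ℝ (Fin 3) → ℝ⦄,
      IsClassicalNSSolutionOn (Icc 0 T') ν f u p → u 0 = u₀ →
      HasBoundedSobolevNormsOn (Icc 0 T') u →
      HasBoundedSobolevNormsOn (Icc 0 T') (timeDerivWithin (Icc 0 T') u) →
      (∀ n : ℕ, ∃ C : ℝ≥0, ∀ t ∈ Icc 0 T', ∫⁻ x, ‖iteratedFDeriv ℝ n (p t) x‖ₑ ^ 2 ≤ C) →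
      ∀ t ∈ Icc 0 T', (∫⁻ x, ‖u t x‖ₑ ^ 2) +
        (∫⁻ x, ENNReal.ofReal (frobeniusNormSq (fderiv ℝ (u t) x))) ≤ ENNReal.ofReal (Astar ^ 2) := by
    intro T' hT'0 hle u p hsol hu0 hu hut hp t ht
    have hfS' : IsSmoothSpaceTimeOn (Icc 0 T') f := hfs.isSmoothSpaceTimeOn_Icc T'
    have hfD' : HasUniformRapidDecayOn (Icc 0 T') f := hfd.hasUniformRapidDecayOn_Icc hfs hT'0
    -- energy
    obtain ⟨C₀, hC₀⟩ := hu 0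
    have hfin : ∃ A' : ℝ≥0, ∀ s ∈ Icc 0 T', ∫⁻ x, ‖u s x‖ₑ ^ 2 ≤ A' :=
      ⟨C₀, fun s hs => hzero (hC₀ s hs)⟩
    have h1 := (hEn hν hT'0 hsol hfS' ((hfE hle).trans_lt ENNReal.ofReal_lt_top) hfin).1 t ht
    have hu00 : ∫⁻ x, ‖u 0 x‖ₑ ^ 2 ≤ ENNReal.ofReal A := by
      rw [hu0]; exact le_trans le_self_add h0
    have hfE' := hfE hle
    have hE : ∫⁻ x, ‖u t x‖ₑ ^ 2 ≤ Eb :=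
      h1.trans (by
        rw [hEb]
        gcongr)
    -- enstrophy
    have h0' : ∫⁻ x, ENNReal.ofReal (frobeniusNormSq (fderiv ℝ (u 0) x)) ≤ ENNReal.ofReal A := by
      rw [hu0]; exact le_trans le_add_self h0
    have hsmall' : (Real.sqrt A + B) ^ 4 * T' ≤ c₂ * ν ^ 3 :=
      (mul_le_mul_of_nonneg_left hle (by positivity)).trans hsmall
    have h2 := (hapr hν hT'0 hsol hu hut hp hfS' hfD' hA hB h0' (hBG hT'0 hle) hsmall').1 t ht
    -- sum
    calc (∫⁻ x, ‖u t x‖ₑ ^ 2) + (∫⁻ x, ENNReal.ofReal (frobeniusNormSq (fderiv ℝ (u t) x)))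
        ≤ Eb + ENNReal.ofReal (K * (Real.sqrt A + B) ^ 2) := add_le_add hE h2
      _ = ENNReal.ofReal (Eb.toReal + K * M ^ 2) := by
          rw [hM, ENNReal.ofReal_add ENNReal.toReal_nonneg (by positivity),
            ENNReal.ofReal_toReal hEbtop.ne]
      _ ≤ ENNReal.ofReal (Astar ^ 2) := ENNReal.ofReal_le_ofReal (by rw [hAstar_sq]; linarith)
  -- the uniform step
  obtain ⟨h, hh, hstep⟩ := TaoForcedHC.exists_small_step hAstar0 hBF0 hc₁ hν
  -- one application of F2 from a datum of size `≤ A*` with the shifted force, for time `≤ h`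
  have hsolve : ∀ ⦃a T₂ : ℝ⦄, 0 ≤ a → 0 < T₂ → T₂ ≤ h →
      ∀ ⦃g : EuclideanSpace ℝ (Fin 3) → EuclideanSpace ℝ (Fin 3)⦄,
      ContDiff ℝ ∞ g → VectorCalculus.IsDivFree g →
      (∀ n : ℕ, ∫⁻ x, ‖iteratedFDeriv ℝ n g x‖ₑ ^ 2 < ⊤) →
      (∫⁻ x, ‖g x‖ₑ ^ 2) + (∫⁻ x, ENNReal.ofReal (frobeniusNormSq (fderiv ℝ g x))) ≤
          ENNReal.ofReal (Astar ^ 2) →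
      ∃ (u : ℝ → EuclideanSpace ℝ (Fin 3) → EuclideanSpace ℝ (Fin 3))
        (p : ℝ → EuclideanSpace ℝ (Fin 3) → ℝ),
        IsClassicalNSSolutionOn (Icc 0 T₂) ν (fun t => f (t + a)) u p ∧ u 0 = g ∧
        HasBoundedSobolevNormsOn (Icc 0 T₂) u ∧
        HasBoundedSobolevNormsOn (Icc 0 T₂) (timeDerivWithin (Icc 0 T₂) u) ∧
        (∀ n : ℕ, ∃ C : ℝ≥0, ∀ t ∈ Icc 0 T₂, ∫⁻ x, ‖iteratedFDeriv ℝ n (p t) x‖ₑ ^ 2 ≤ C) ∧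
        ContinuousInLpOn (Icc 0 T₂) 2 u := by
    intro a T₂ ha hT₂ hT₂h g hg hgdiv hgH hgsize
    have hsmall₂ : (Astar + BF * T₂) ^ 4 * T₂ ≤ c₁ * ν ^ 3 := by
      have h1 : Astar + BF * T₂ ≤ Astar + BF * h := by nlinarith
      have h2 : (Astar + BF * T₂) ^ 4 ≤ (Astar + BF * h) ^ 4 :=
        pow_le_pow_left₀ (by positivity) h1 4
      calc (Astar + BF * T₂) ^ 4 * T₂ ≤ (Astar + BF * h) ^ 4 * h :=
            mul_le_mul h2 hT₂h hT₂.le (by positivity)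
        _ ≤ c₁ * ν ^ 3 := hstep
    exact hloc hν hT₂ hg hgdiv hgH (hfs.isSmoothSpaceTimeOn_Icc_timeShift ha T₂)
      (hfd.hasUniformRapidDecayOn_Icc_timeShift hfs ha hT₂) hAstar0 hBF0 hgsize
      (fun t ht => hBF (t + a) (by linarith [ht.1])) hsmall₂
  -- the iteration: a Tao-class solution on `[0, min T ((n+1) h/2)]` for every `n`
  have key : ∀ n : ℕ, ∃ (u : ℝ → EuclideanSpace ℝ (Fin 3) → EuclideanSpace ℝ (Fin 3))
      (p : ℝ → EuclideanSpace ℝ (Fin 3) → ℝ),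
      IsClassicalNSSolutionOn (Icc 0 (min T (((n : ℝ) + 1) * (h / 2)))) ν f u p ∧ u 0 = u₀ ∧
      HasBoundedSobolevNormsOn (Icc 0 (min T (((n : ℝ) + 1) * (h / 2)))) u ∧
      HasBoundedSobolevNormsOn (Icc 0 (min T (((n : ℝ) + 1) * (h / 2))))
        (timeDerivWithin (Icc 0 (min T (((n : ℝ) + 1) * (h / 2)))) u) ∧
      (∀ k : ℕ, ∃ C : ℝ≥0, ∀ t ∈ Icc 0 (min T (((n : ℝ) + 1) * (h / 2))),
        ∫⁻ x, ‖iteratedFDeriv ℝ k (p t) x‖ₑ ^ 2 ≤ C) ∧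
      ContinuousInLpOn (Icc 0 (min T (((n : ℝ) + 1) * (h / 2)))) 2 u := by
    intro n
    induction n with
    | zero =>
        have hT0 : 0 < min T (((0 : ℕ) : ℝ) + 1) * (h / 2) := by positivity
        have hT0' : 0 < min T ((((0 : ℕ) : ℝ) + 1) * (h / 2)) := lt_min hT (by positivity)
        have hT0h : min T ((((0 : ℕ) : ℝ) + 1) * (h / 2)) ≤ h :=
          (min_le_right _ _).trans (by norm_num; linarith)
        obtain ⟨u, p, hsol, hu0, hu, hut, hp, hc⟩ :=
          hsolve le_rfl hT0' hT0h hu₀ hdiv hH (h0.trans hA_le)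
        simp only [add_zero] at hsol
        exact ⟨u, p, hsol, hu0, hu, hut, hp, hc⟩
    | succ n ih =>
        obtain ⟨u, p, hsol, hu0, hu, hut, hp, hc⟩ := ih
        set τ : ℝ := min T (((n : ℝ) + 1) * (h / 2)) with hτ
        have hgoal : min T ((((n + 1 : ℕ) : ℝ) + 1) * (h / 2)) = min T (((n : ℝ) + 1) * (h / 2) + h / 2) := by
          push_cast; ring_nf
        rw [hgoal]
        by_cases hcase : T ≤ ((n : ℝ) + 1) * (h / 2)
        · -- the slab is already `[0, T]`
          have e1 : τ = T := min_eq_left hcase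
          have e2 : min T (((n : ℝ) + 1) * (h / 2) + h / 2) = T := min_eq_left (by linarith)
          rw [e2]
          rw [e1] at hsol hu hut hp hc
          exact ⟨u, p, hsol, hu0, hu, hut, hp, hc⟩
        · rw [not_le] at hcase
          have e1 : τ = ((n : ℝ) + 1) * (h / 2) := min_eq_right hcase.le
          have hτT : τ < T := by rw [e1]; exact hcase
          have hτh : h / 2 ≤ τ := by
            rw [e1]
            have : (1 : ℝ) ≤ (n : ℝ) + 1 := by linarith [(n.cast_nonneg : (0 : ℝ) ≤ n)]
            nlinarith
          have hτ0 : 0 < τ := by linarith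
          -- restart time and length
          set a : ℝ := τ - h / 4 with ha_def
          have ha : 0 ≤ a := by rw [ha_def]; linarith
          have haτ : a < τ := by rw [ha_def]; linarith
          have haI : a ∈ Icc 0 τ := ⟨ha, haτ.le⟩
          set T₂ : ℝ := min (T - a) (3 * h / 4) with hT₂_def
          have hT₂ : 0 < T₂ := lt_min (by linarith) (by linarith)
          have hT₂h : T₂ ≤ h := (min_le_right _ _).trans (by linarith)
          have hτle : τ ≤ a + T₂ := by
            rw [hT₂_def, ← min_add_add_left, ha_def]
            exact le_min (by linarith) (by linarith)
          have hend : a + T₂ = min T (((n : ℝ) + 1) * (h / 2) + h / 2) := by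
            rw [hT₂_def, ← min_add_add_left, ha_def, e1]
            congr 1 <;> ring
          -- the restart datum `u a` has size `≤ A*`
          have hsize := hapriori hτ0 hτT.le hsol hu0 hu hut hp a haI
          have hHa : ∀ k : ℕ, ∫⁻ x, ‖iteratedFDeriv ℝ k (u a) x‖ₑ ^ 2 < ⊤ := fun k => by
            obtain ⟨C, hC⟩ := hu k
            exact (hC a haI).trans_lt ENNReal.coe_lt_top
          obtain ⟨v, q, hv, hv0, hvs, hvd, hvq, hvc⟩ :=
            hsolve ha hT₂ hT₂h (hsol.contDiff_velocity haI) (hsol.divFree a haI) hHa hsize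
          obtain ⟨w, r, hw, hw0, hws, hwd, hwr, hwc, -⟩ :=
            taoClass_glue_forced hsol hu hut hp hc hv hvs hvd hvq hvc hv0 hν hT₂ ha haτ hτle
          rw [← hend]
          exact ⟨w, r, hw, hw0.trans hu0, hws, hwd, hwr, hwc⟩
  -- conclusion: after finitely many steps the slab is `[0, T]`
  obtain ⟨n, hn⟩ := exists_nat_gt (T / (h / 2))
  have hnT : T ≤ ((n : ℝ) + 1) * (h / 2) := by
    have h2 : 0 < h / 2 := by linarith
    rw [div_lt_iff₀ h2] at hn
    nlinarith
  have e : min T (((n : ℝ) + 1) * (h / 2)) = T := min_eq_left hnT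
  obtain ⟨u, p, hsol, hu0, hu, hut, hp, hc⟩ := key n
  rw [e] at hsol hu hut hp hc
  exact ⟨u, p, hsol, hu0, hu, hut, hp, hc⟩

end FullSlab

end Literature.Analysis.FluidPDE

end
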